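import Summits.QuantumAdvantage.QuantumAdvantage.Theorems.MobiusLadderLiouvilleNotPPolyTwinKernel
import Literature.NumberTheory.LFunctions.RHWave0GRHProofs
import Literature.NumberTheory.QuadraticFields.KroneckerCharacterFourProofs
import Literature.NumberTheory.Sieve.JurkatRichertRefutation
import Literature.Computability.MetaComplexity.AvgPLevinOfAvgP
import Literature.NumberTheory.LFunctions.GRHCharacterPrimeSums

/-!
# Twin-freeness in density is GRH-true: the calibration of stub TF of line `Sketch`
(crux `MobiusLadder.LiouvilleNotPPoly`, stmt-QuantumAdvantage-1389)

Helper file (continuation lead c2, line `Sketch`). The line's composition is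
`CR → TF → LiouvilleNotPPoly` (`liouvilleNotPPoly_of_charRigidity_twinFreeDensity`, landed), with
TF = "every `d` of at most `n^k` bits is non-inert, `(d | p) ≠ −1`, at three eighths of the primes
below `2^n`, eventually in `n`". Here TF is derived from the Generalised Riemann Hypothesis for
Dirichlet `L`-functions (`Literature.NumberTheory.LFunctions.GeneralizedRiemannHypothesis`, rh.S02,
open) through the GRH-conditional prime number theorem for characters (Titchmarsh 1930;
Montgomery–Vaughan Thm. 13.7, eq. (13.21): `π(x, χ) = O(x^{1/2} log qx)` for `χ ≠ χ₀`, stated below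
as a named fact with its locator), and Chebyshev's lower bound `π(2^n) ≫ 2^n / n` (Mathlib
`Chebyshev.pi_ge`): for the Kronecker character `χ_d` mod `4|d|` the inert primes exceed the split
ones by at most `C 2^{n/2} (n^k + n + 2) log 2 = o(π(2^n))`. Consequently the line reads, as tree
theorems: `CR ∧ GRH ⟹ L_λ ∉ P/poly` (corollary `liouvilleNotPPoly_of_charRigidity_GRH`).
-/

set_option linter.dupNamespace false -- D-0017: single-problem summit ⇒ `QuantumAdvantage.QuantumAdvantage` by design

noncomputable section

namespace Summit.QuantumAdvantage.QuantumAdvantage.Theorems.LiouvilleNotPPoly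

open Filter Finset Real Topology

namespace TwinFreeGRH

/-! ### Counting primes below `2^n` -/

/-- For `n ≥ 2`, the primes `< 2^n` are the primes `≤ 2^n`: `#{p < 2^n} = π(2^n)`. -/
theorem card_filter_prime_range_eq_primeCounting {n : ℕ} (hn : 2 ≤ n) :
    ((range (2 ^ n)).filter Nat.Prime).card = Nat.primeCounting (2 ^ n) := by
  rw [Nat.primeCounting, Nat.primeCounting', Nat.count_eq_card_filter_range, Finset.range_add_one,
    Finset.filter_insert, if_neg (Literature.NumberTheory.Sieve.PairProducts.not_prime_two_pow hn)]

/-- For `n ≥ 2`, the primes in `[0, 2^n]` are the primes `< 2^n`. -/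
theorem filter_prime_Iic_eq_range {n : ℕ} (hn : 2 ≤ n) :
    (Iic (2 ^ n)).filter Nat.Prime = (range (2 ^ n)).filter Nat.Prime := by
  ext p
  simp only [Finset.mem_filter, Finset.mem_Iic, Finset.mem_range]
  constructor
  · rintro ⟨hp, hpr⟩
    refine ⟨lt_of_le_of_ne hp ?_, hpr⟩
    rintro rfl
    exact Literature.NumberTheory.Sieve.PairProducts.not_prime_two_pow hn hpr
  · rintro ⟨hp, hpr⟩
    exact ⟨hp.le, hpr⟩

/-- **Chebyshev's lower bound at `2^n`**: `2^n / (2n) ≤ #{p < 2^n prime}` for `n ≥ 3`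
(Mathlib `Chebyshev.pi_ge`: `(N log 2 − log(N+1)) / log N ≤ π(N)`, with `log(2^n + 1) ≤ (n+1) log 2`
and `2^n ≥ 2n + 2`). -/
theorem two_pow_div_le_card {n : ℕ} (hn : 3 ≤ n) :
    (2 : ℝ) ^ n / (2 * n) ≤ (((range (2 ^ n)).filter Nat.Prime).card : ℝ) := by
  rw [card_filter_prime_range_eq_primeCounting (by omega)]
  have hcheb := Chebyshev.pi_ge (2 ^ n)
  push_cast at hcheb
  have hlog2 : 0 < Real.log 2 := Real.log_pos (by norm_num)
  have hn0 : (0 : ℝ) < n := by exact_mod_cast (show 0 < n by omega)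
  have hlogpow : Real.log ((2 : ℝ) ^ n) = n * Real.log 2 := by
    rw [Real.log_pow]
  rw [hlogpow] at hcheb
  -- `log (2^n + 1) ≤ (n + 1) log 2`
  have hl : Real.log ((2 : ℝ) ^ n + 1) ≤ (n + 1) * Real.log 2 := by
    rw [← Real.log_pow] at *
    have : Real.log ((2 : ℝ) ^ n + 1) ≤ Real.log ((2 : ℝ) ^ (n + 1)) :=
      Real.log_le_log (by positivity) (by rw [pow_succ]; linarith [one_le_pow₀ (show (1:ℝ) ≤ 2 by norm_num) (n := n)])
    rwa [Real.log_pow, Nat.cast_add, Nat.cast_one] at this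
  -- `2^n ≥ 2n + 2`
  have hpow : (2 : ℝ) * n + 2 ≤ (2 : ℝ) ^ n := by
    have h : ∀ m : ℕ, 3 ≤ m → 2 * m + 2 ≤ 2 ^ m := by
      intro m hm
      induction m, hm using Nat.le_induction with
      | base => norm_num
      | succ m hm ih => rw [pow_succ]; omega
    exact_mod_cast h n hn
  calc (2 : ℝ) ^ n / (2 * n) = ((2 : ℝ) ^ n / 2) / n := by rw [div_div]
    _ ≤ ((2 : ℝ) ^ n * Real.log 2 - Real.log ((2 : ℝ) ^ n + 1)) / (n * Real.log 2) := by
        rw [div_le_div_iff₀ hn0 (by positivity)]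
        have : ((2 : ℝ) ^ n / 2) * (n * Real.log 2) =
            ((2 : ℝ) ^ n * Real.log 2 - ((2 : ℝ) ^ n / 2) * Real.log 2) * n := by ring
        rw [this]
        refine mul_le_mul_of_nonneg_right ?_ hn0.le
        nlinarith
    _ ≤ _ := hcheb

/-! ### The analytic threshold -/

/-- **The error terms are eventually negligible**: for fixed `C` and `k`, eventually in `n`,
`4·(C (√2)^n (n^k + n + 2) log 2) + 4 ≤ 2^n / (2n)` (exponential beats polynomial:
`n^j / (√2)^n → 0`). -/
theorem eventually_error_le (C : ℝ) (k : ℕ) :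
    ∀ᶠ n : ℕ in atTop,
      4 * (C * Real.sqrt 2 ^ n * ((n : ℝ) ^ k + n + 2) * Real.log 2) + 4 ≤ (2 : ℝ) ^ n / (2 * n) := by
  have hr : (1 : ℝ) < Real.sqrt 2 := by
    rw [show (1 : ℝ) = Real.sqrt 1 by simp]
    exact Real.sqrt_lt_sqrt (by norm_num) (by norm_num)
  have h2 : (1 : ℝ) < 2 := by norm_num
  -- the normalised error `(8 C log 2 (n^k + n + 2) n) / (√2)^n + 8 n / 2^n → 0`
  have t1 : Tendsto (fun n : ℕ => (n : ℝ) ^ (k + 1) / Real.sqrt 2 ^ n) atTop (𝓝 0) :=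
    tendsto_pow_const_div_const_pow_of_one_lt (k + 1) hr
  have t2 : Tendsto (fun n : ℕ => (n : ℝ) ^ 2 / Real.sqrt 2 ^ n) atTop (𝓝 0) :=
    tendsto_pow_const_div_const_pow_of_one_lt 2 hr
  have t3 : Tendsto (fun n : ℕ => (n : ℝ) ^ 1 / Real.sqrt 2 ^ n) atTop (𝓝 0) :=
    tendsto_pow_const_div_const_pow_of_one_lt 1 hr
  have t4 : Tendsto (fun n : ℕ => (n : ℝ) ^ 1 / (2 : ℝ) ^ n) atTop (𝓝 0) :=
    tendsto_pow_const_div_const_pow_of_one_lt 1 h2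
  have tsum : Tendsto (fun n : ℕ => 8 * C * Real.log 2 *
      ((n : ℝ) ^ (k + 1) / Real.sqrt 2 ^ n + (n : ℝ) ^ 2 / Real.sqrt 2 ^ n + 2 * ((n : ℝ) ^ 1 / Real.sqrt 2 ^ n)) +
      8 * ((n : ℝ) ^ 1 / (2 : ℝ) ^ n)) atTop (𝓝 0) := by
    have := ((t1.add t2).add (t3.const_mul 2)).const_mul (8 * C * Real.log 2)
    have := this.add (t4.const_mul 8)
    simpa using this
  have hev := (tendsto_order.1 tsum).2 1 (by norm_num)
  filter_upwards [hev, eventually_ge_atTop 1] with n hn hn1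
  have hn0 : (0 : ℝ) < n := by exact_mod_cast (show 0 < n by omega)
  have hs0 : 0 < Real.sqrt 2 ^ n := by positivity
  have hp0 : (0 : ℝ) < 2 ^ n := by positivity
  have hss : Real.sqrt 2 ^ n * Real.sqrt 2 ^ n = (2 : ℝ) ^ n := by
    rw [← mul_pow, Real.mul_self_sqrt (by norm_num : (0 : ℝ) ≤ 2)]
  simp only [pow_one] at hn
  -- multiply the normalised inequality by `2^n / (2 n) > 0`
  rw [le_div_iff₀ (by positivity)]
  have key : (8 * C * Real.log 2 *
      ((n : ℝ) ^ (k + 1) / Real.sqrt 2 ^ n + (n : ℝ) ^ 2 / Real.sqrt 2 ^ n + 2 * ((n : ℝ) / Real.sqrt 2 ^ n)) +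
      8 * ((n : ℝ) / (2 : ℝ) ^ n)) * (2 : ℝ) ^ n =
      (4 * (C * Real.sqrt 2 ^ n * ((n : ℝ) ^ k + n + 2) * Real.log 2) + 4) * (2 * n) := by
    have hs : Real.sqrt 2 ^ n ≠ 0 := hs0.ne'
    rw [← hss]
    field_simp
    ring
  have hlt := mul_lt_mul_of_pos_right hn hp0
  rw [key, one_mul] at hlt
  exact hlt.le

/-! ### The character count at one scale -/

/-- **The split/inert count from a character-sum bound.** Let `S` be the odd primes below `2^n`,
`P = {p ∈ S : (d|p) = 1}`, `I = {p ∈ S : (d|p) = −1}`. Then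
`∑_{p ∈ S} (d | p) = #P − #I`. -/
theorem sum_jacobiSym_eq_card_sub_card (d : ℤ) (n : ℕ) :
    (∑ p ∈ (range (2 ^ n)).filter (fun p => p.Prime ∧ p ≠ 2), (jacobiSym d p : ℝ)) =
      (((range (2 ^ n)).filter fun p => (p.Prime ∧ p ≠ 2) ∧ jacobiSym d p = 1).card : ℝ) -
        (((range (2 ^ n)).filter fun p => (p.Prime ∧ p ≠ 2) ∧ jacobiSym d p = -1).card : ℝ) := by
  have hdecomp : ∀ p ∈ (range (2 ^ n)).filter (fun p => p.Prime ∧ p ≠ 2), (jacobiSym d p : ℝ) =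
      (if jacobiSym d p = 1 then (1 : ℝ) else 0) - (if jacobiSym d p = -1 then (1 : ℝ) else 0) := by
    intro p _
    rcases jacobiSym.trichotomy d p with h | h | h <;> simp [h]
  rw [Finset.sum_congr rfl hdecomp, Finset.sum_sub_distrib, Finset.sum_boole, Finset.sum_boole,
    Finset.filter_filter, Finset.filter_filter]

end TwinFreeGRH

open TwinFreeGRH

/-- **TF at one scale from a lower bound for the Jacobi sum over odd primes.** If
`−E ≤ ∑_{2 < p < 2^n} (d | p)` and `4E + 4 ≤ #{p < 2^n}`, then
`3 · #{p < 2^n} ≤ 8 · #{p < 2^n : (d|p) ≠ −1}` (with `P`/`I` the odd primes where `(d|p) = ±1`: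
`∑ = #P − #I`, `#P ≤ #A`, `#{p < 2^n} ≤ #A + #I + 1`). -/
theorem three_mul_card_le_of_sum_ge (d : ℤ) (n : ℕ) {E : ℝ}
    (hsum : -E ≤ ∑ p ∈ (range (2 ^ n)).filter (fun p => p.Prime ∧ p ≠ 2), (jacobiSym d p : ℝ))
    (hE : 4 * E + 4 ≤ (((range (2 ^ n)).filter Nat.Prime).card : ℝ)) :
    3 * ((range (2 ^ n)).filter Nat.Prime).card ≤
      8 * ((range (2 ^ n)).filter fun p => p.Prime ∧ jacobiSym d p ≠ -1).card := by
  classical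
  set S := (range (2 ^ n)).filter Nat.Prime with hS
  set A := (range (2 ^ n)).filter (fun p => p.Prime ∧ jacobiSym d p ≠ -1) with hA
  set P := (range (2 ^ n)).filter (fun p => (p.Prime ∧ p ≠ 2) ∧ jacobiSym d p = 1) with hP
  set I := (range (2 ^ n)).filter (fun p => (p.Prime ∧ p ≠ 2) ∧ jacobiSym d p = -1) with hI
  -- (i) `#S ≤ #A + #I + 1`
  have h1 : S.card ≤ A.card + I.card + 1 := by
    have hsub : S ⊆ A ∪ I ∪ {2} := by
      intro p hp
      rw [hS, Finset.mem_filter] at hp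
      by_cases hJ : jacobiSym d p = -1
      · by_cases hp2 : p = 2
        · simp [hp2]
        · exact Finset.mem_union_left _ (Finset.mem_union_right _
            (Finset.mem_filter.2 ⟨hp.1, ⟨hp.2, hp2⟩, hJ⟩))
      · exact Finset.mem_union_left _ (Finset.mem_union_left _ (Finset.mem_filter.2 ⟨hp.1, hp.2, hJ⟩))
    calc S.card ≤ (A ∪ I ∪ {2}).card := Finset.card_le_card hsub
      _ ≤ (A ∪ I).card + ({2} : Finset ℕ).card := Finset.card_union_le _ _
      _ ≤ A.card + I.card + 1 := by
          have := Finset.card_union_le A I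
          simp only [Finset.card_singleton]
          omega
  -- (ii) `#P ≤ #A`
  have h2 : P.card ≤ A.card := by
    refine Finset.card_le_card fun p hp => ?_
    rw [hP, Finset.mem_filter] at hp
    exact Finset.mem_filter.2 ⟨hp.1, hp.2.1.1, by rw [hp.2.2]; norm_num⟩
  -- (iii) `#I ≤ #P + E`
  have h3 : (I.card : ℝ) ≤ P.card + E := by
    have := sum_jacobiSym_eq_card_sub_card d n
    rw [this] at hsum
    linarith
  have h1' : (S.card : ℝ) ≤ A.card + I.card + 1 := by exact_mod_cast h1
  have h2' : (P.card : ℝ) ≤ A.card := by exact_mod_cast h2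
  have hfin : (3 * S.card : ℝ) ≤ 8 * A.card := by linarith
  exact_mod_cast hfin

/-- **Twin-freeness in density follows from GRH** (given the GRH-conditional prime number theorem
for characters, Montgomery–Vaughan Thm. 13.7 (13.21)): for every `k`, eventually in `n`, every
`d` with `|d| ≤ 2^{n^k}` is non-inert at three eighths of the primes below `2^n`. This is the
registered statement of stub TF (`stub_twinFreeDensity`) of line `Sketch`, under GRH. -/
theorem twinFreeDensity_of_GRH :
    Literature.NumberTheory.LFunctions.grh_primeCharSum_le → Literature.NumberTheory.LFunctions.GeneralizedRiemannHypothesis →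
    ∀ k : ℕ, ∀ᶠ n : ℕ in Filter.atTop, ∀ d : ℤ, |d| ≤ 2 ^ n ^ k →
      3 * ((Finset.range (2 ^ n)).filter Nat.Prime).card ≤
        8 * ((Finset.range (2 ^ n)).filter fun p => p.Prime ∧ jacobiSym d p ≠ -1).card := by
  rintro ⟨C, hC⟩ hGRH k
  set C' : ℝ := max C 0 with hC'
  have hC'0 : 0 ≤ C' := le_max_right _ _
  filter_upwards [eventually_error_le C' k, eventually_ge_atTop 3] with n herr hn3 d hd
  have hn2 : 2 ≤ n := by omega
  have hcard := two_pow_div_le_card hn3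
  -- the threshold `4 E' + 4 ≤ #{p < 2^n}` for `E' = C' (√2)^n (n^k + n + 2) log 2`
  set E' : ℝ := C' * Real.sqrt 2 ^ n * ((n : ℝ) ^ k + n + 2) * Real.log 2 with hE'
  have hthr : 4 * E' + 4 ≤ (((range (2 ^ n)).filter Nat.Prime).card : ℝ) := herr.trans hcard
  -- trivial cases: `d = 0`
  by_cases hd0 : d = 0
  · subst hd0
    have hA : ((range (2 ^ n)).filter fun p => p.Prime ∧ jacobiSym 0 p ≠ -1) =
        (range (2 ^ n)).filter Nat.Prime := by
      refine Finset.filter_congr fun p _ => ⟨fun h => h.1, fun hp => ⟨hp, ?_⟩⟩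
      rw [jacobiSym.zero_left hp.one_lt]
      norm_num
    rw [hA]
    omega
  -- the Kronecker character mod `4|d|`
  haveI : NeZero (4 * d.natAbs) := ⟨mul_ne_zero (by norm_num) (Int.natAbs_ne_zero.2 hd0)⟩
  obtain ⟨χ, hχ⟩ := Literature.NumberTheory.QuadraticFields.exists_dirichletCharacter_four_mul d hd0
  have hχ2 : χ 2 = 0 := by
    refine χ.map_nonunit fun hu => ?_
    have hu' : IsUnit ((2 : ℕ) : ZMod (4 * d.natAbs)) := by exact_mod_cast hu
    have hcop := (ZMod.isUnit_iff_coprime 2 (4 * d.natAbs)).1 hu'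
    have : Nat.gcd 2 (4 * d.natAbs) = 2 := Nat.gcd_eq_left ⟨2 * d.natAbs, by ring⟩
    rw [Nat.Coprime, this] at hcop
    norm_num at hcop
  have hE'0 : 0 ≤ E' := by
    have : 0 ≤ Real.log 2 := Real.log_nonneg (by norm_num)
    positivity
  -- the sum over odd primes `< 2^n` of `(d|p)`, and its relation to `∑ χ(p)`
  set Sodd := (range (2 ^ n)).filter (fun p => p.Prime ∧ p ≠ 2) with hSodd
  have hsplit : ∑ p ∈ (range (2 ^ n)).filter Nat.Prime, χ p = ∑ p ∈ Sodd, (jacobiSym d p : ℂ) := by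
    have hSeq : Sodd = ((range (2 ^ n)).filter Nat.Prime).filter (fun p => p ≠ 2) := by
      rw [hSodd, Finset.filter_filter]
    rw [hSeq]
    conv_rhs => rw [Finset.sum_filter]
    refine Finset.sum_congr rfl fun p hp => ?_
    rw [Finset.mem_filter] at hp
    by_cases hp2 : p = 2
    · simp [hp2, hχ2]
    · rw [if_pos hp2]
      exact hχ p (hp.2.odd_of_ne_two hp2)
  have hre : (∑ p ∈ Sodd, (jacobiSym d p : ℂ)).re = ∑ p ∈ Sodd, (jacobiSym d p : ℝ) := by
    rw [Complex.re_sum]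
    exact Finset.sum_congr rfl fun p _ => by simp
  by_cases hχ1 : χ = 1
  · -- principal: `(d|p) = χ(p) ∈ {0, 1}` at odd primes, so the Jacobi sum is `≥ 0 ≥ −E'`
    refine three_mul_card_le_of_sum_ge d n (E := E') ?_ hthr
    have hnn : ∀ p ∈ Sodd, (0 : ℝ) ≤ (jacobiSym d p : ℝ) := by
      intro p hp
      rw [hSodd, Finset.mem_filter] at hp
      have hv := hχ p (hp.2.1.odd_of_ne_two hp.2.2)
      rw [hχ1] at hv
      by_cases hu : IsUnit ((p : ℕ) : ZMod (4 * d.natAbs))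
      · rw [MulChar.one_apply hu] at hv
        have : jacobiSym d p = 1 := by exact_mod_cast hv.symm
        rw [this]; norm_num
      · rw [MulChar.map_nonunit _ hu] at hv
        have : jacobiSym d p = 0 := by exact_mod_cast hv.symm
        rw [this]; norm_num
    have := Finset.sum_nonneg hnn
    linarith
  · -- non-principal: GRH + the conditional PNT for characters
    have hRH : ∀ ψ : DirichletCharacter ℂ (4 * d.natAbs), ψ.RiemannHypothesis := fun ψ =>
      hGRH.dirichletCharacter ψ
    have hx2 : (2 : ℝ) ≤ (2 : ℝ) ^ n := by
      calc (2 : ℝ) = 2 ^ 1 := by norm_num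
        _ ≤ 2 ^ n := pow_le_pow_right₀ (by norm_num) (by omega)
    have hfact := hC (4 * d.natAbs) hRH χ hχ1 ((2 : ℝ) ^ n) hx2
    have hfloor : ⌊(2 : ℝ) ^ n⌋₊ = 2 ^ n := by
      rw [show (2 : ℝ) ^ n = ((2 ^ n : ℕ) : ℝ) by push_cast; ring, Nat.floor_natCast]
    rw [hfloor, filter_prime_Iic_eq_range hn2] at hfact
    -- bound the analytic error by `E'`
    have hq : ((4 * d.natAbs : ℕ) : ℝ) * (2 : ℝ) ^ n ≤ (2 : ℝ) ^ (n ^ k + n + 2) := by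
      have habs : ((d.natAbs : ℕ) : ℝ) ≤ (2 : ℝ) ^ n ^ k := by
        have h1 : ((d.natAbs : ℕ) : ℝ) = ((|d| : ℤ) : ℝ) := Nat.cast_natAbs d
        have h2 : ((|d| : ℤ) : ℝ) ≤ (2 : ℝ) ^ n ^ k := by exact_mod_cast hd
        rw [h1]
        exact h2
      calc ((4 * d.natAbs : ℕ) : ℝ) * (2 : ℝ) ^ n = 4 * ((d.natAbs : ℕ) : ℝ) * 2 ^ n := by push_cast; ring
        _ ≤ 4 * (2 : ℝ) ^ n ^ k * 2 ^ n := by gcongr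
        _ = (2 : ℝ) ^ (n ^ k + n + 2) := by rw [pow_add, pow_add]; norm_num; ring
    have hlog : Real.log (((4 * d.natAbs : ℕ) : ℝ) * (2 : ℝ) ^ n) ≤ ((n : ℝ) ^ k + n + 2) * Real.log 2 := by
      have hpos : (0 : ℝ) < ((4 * d.natAbs : ℕ) : ℝ) * (2 : ℝ) ^ n := by
        have : (0 : ℝ) < ((4 * d.natAbs : ℕ) : ℝ) := by
          exact_mod_cast Nat.pos_of_ne_zero (NeZero.ne (4 * d.natAbs))
        positivity
      calc Real.log (((4 * d.natAbs : ℕ) : ℝ) * (2 : ℝ) ^ n) ≤ Real.log ((2 : ℝ) ^ (n ^ k + n + 2)) :=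
            Real.log_le_log hpos hq
        _ = ((n ^ k + n + 2 : ℕ) : ℝ) * Real.log 2 := by rw [Real.log_pow]
        _ = ((n : ℝ) ^ k + n + 2) * Real.log 2 := by push_cast; ring
    have hlog0 : 0 ≤ Real.log (((4 * d.natAbs : ℕ) : ℝ) * (2 : ℝ) ^ n) := by
      refine Real.log_nonneg ?_
      have h4 : (1 : ℝ) ≤ ((4 * d.natAbs : ℕ) : ℝ) := by
        exact_mod_cast Nat.pos_of_ne_zero (NeZero.ne (4 * d.natAbs))
      have h2n : (1 : ℝ) ≤ (2 : ℝ) ^ n := one_le_pow₀ (by norm_num)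
      nlinarith
    have hsqrt : ((2 : ℝ) ^ n) ^ (1 / 2 : ℝ) = Real.sqrt 2 ^ n := by
      rw [← Real.sqrt_eq_rpow, Literature.Computability.MetaComplexity.sqrt_two_pow]
    rw [hsqrt] at hfact
    have hbound : C * Real.sqrt 2 ^ n * Real.log (((4 * d.natAbs : ℕ) : ℝ) * (2 : ℝ) ^ n) ≤ E' := by
      have hs0 : 0 ≤ Real.sqrt 2 ^ n := by positivity
      calc C * Real.sqrt 2 ^ n * Real.log (((4 * d.natAbs : ℕ) : ℝ) * (2 : ℝ) ^ n)
          ≤ C' * Real.sqrt 2 ^ n * Real.log (((4 * d.natAbs : ℕ) : ℝ) * (2 : ℝ) ^ n) := by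
            gcongr
            exact le_max_left _ _
        _ ≤ C' * Real.sqrt 2 ^ n * (((n : ℝ) ^ k + n + 2) * Real.log 2) := by gcongr
        _ = E' := by rw [hE']; ring
    refine three_mul_card_le_of_sum_ge d n (E := E') ?_ hthr
    have hnorm : ‖∑ p ∈ Sodd, (jacobiSym d p : ℂ)‖ ≤ E' := by
      rw [← hsplit]; exact hfact.trans hbound
    have hre_le := Complex.abs_re_le_norm (∑ p ∈ Sodd, (jacobiSym d p : ℂ))
    rw [hre] at hre_le
    have := (abs_le.1 (hre_le.trans hnorm)).1
    linarith

/-- **The line under GRH: character rigidity alone gives the crux.** Given the GRH-conditional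
prime number theorem for characters and GRH, the λ-free hypothesis CR (`stub_charRigidity` of line
`Sketch`: an easy completely multiplicative `±1` function is, at every large scale, a polynomial-bit
Jacobi symbol off an eighth of the primes) implies `L_λ ∉ P/poly`, by the landed composition
`liouvilleNotPPoly_of_charRigidity_twinFreeDensity`. -/
theorem liouvilleNotPPoly_of_charRigidity_GRH (hfact : Literature.NumberTheory.LFunctions.grh_primeCharSum_le)
    (hGRH : Literature.NumberTheory.LFunctions.GeneralizedRiemannHypothesis)
    (hCR : ∀ f : ℕ → ℤ, (∀ m n : ℕ, f (m * n) = f m * f n) → (∀ n : ℕ, n ≠ 0 → f n = 1 ∨ f n = -1) →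
      Computability.encodingNatBool.toLanguage {N : ℕ | f N = -1} ∈
        Literature.Computability.Complexity.PPoly →
      ∃ k : ℕ, ∀ᶠ n : ℕ in Filter.atTop, ∃ d : ℤ, |d| ≤ 2 ^ n ^ k ∧
        8 * ((Finset.range (2 ^ n)).filter fun p => p.Prime ∧ jacobiSym d p ≠ f p).card ≤
          ((Finset.range (2 ^ n)).filter Nat.Prime).card) :
    Summit.QuantumAdvantage.QuantumAdvantage.Theses.MobiusLadder.LiouvilleNotPPoly :=
  liouvilleNotPPoly_of_charRigidity_twinFreeDensity hCR (twinFreeDensity_of_GRH hfact hGRH)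

end Summit.QuantumAdvantage.QuantumAdvantage.Theorems.LiouvilleNotPPoly

end
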